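import Summits.NavierStokesRegularity.NavierStokesRegularity.Theorems.StrainClockDoorsClosers
import Summits.NavierStokesRegularity.NavierStokesRegularity.Theorems.StrainClockThresholdWeighted
import Summits.NavierStokesRegularity.NavierStokesRegularity.Theorems.StrainDoorsGrowthWeighted
import Mathlib.MeasureTheory.Integral.IntervalIntegral.FundThmCalculus
import HarnessLib
import HarnessLib

/-!
# StrainClockLocalDefs — door family S39 «LocalStrainClock»: texts of record (§0–§3)

P0-39 part 1 of 4: §0–§3 (`IsStrainPenalisedArgmax`; doors `LocalStrainTameness` (C1), `PenalisedClockLiouville` (C2), `ForwardStrainSmoothing` (C3), `IntegratedClockNoStretching` (C4♮), `IntegratedClockLiouville` (C4); plate `StrainThresholdWeightedOn`) of nsreg-p1 g32's `r37/Sketch39.v2.lean` sha16 8afe3b1c706e6582 (ROUND-37 S39 «LocalStrainClock»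
65850a92b7bcd814), every declaration byte-identical, order preserved; cut prepared by ns-s29-p2 g4 (planner's suggested split,
compositions halved for the 400-line cap), `--supports stmt-NavierStokesRegularity-0056 --as helper`.  `--kind definition`.
The sketch's module docstring follows verbatim.

HONEST FRAME: door family S39 «LocalStrainClock» = local / penalised / integrated strain-clock CRITERIA about HYPOTHETICAL blow-up
profiles; items 0056 `NoTypeII`, 10661 and NS regularity are NOT proved; nothing here is a route or a summit statement.
-/


/-!
# Sketch39 — door family S39 «LocalStrainClock» (nsreg-p1 g32, ROUND-37): texts of record + kernel-checked compositions

The S38 strain clock (`∂ₛq ≤ −q² + H + η(ε)q` at penalised / almost maximisers of the strain form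
`q = ⟪∇u e,e⟫`, `H = ¼(|ω|² − ⟪ω,e⟩²) − ∇²p(e,e)`; plate E1_S♭ `ArgmaxDoors.strainGrowthWeighted`, p660752) read at
FIXED RESOLUTION and WITH MEMORY.

(C1) «LocalStrainTameness» — RESOLUTION. Keep the penalisation weight `w_ε(x) = (1+ε|x|²)⁻¹` FIXED (`ε = R⁻²`)
instead of sending `ε → 0`: the weighted form `Q = w_ε q` of a bounded ancient solution (`|u| ≤ U`, `‖∇u‖ ≤ L`)
obeys, at its EXACT maximisers (they see only the ball of radius `~R` around the origin), `∂ₛQ ≤ −κQ² + η(ε)Q`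
under feed sub-parity `H ≤ c q²` (`κ = 1 − c`, `η(ε) = 6νε + √ε·U` — the allowance no longer vanishes). The clock
with linear damping has the explicit supersolution `B(s) = η/κ + (L'⁻¹ + κ(s − s₁))⁻¹` (`φ = −κB + η`,
`φB = −ηD − κD² ≤ −κD² = B'`), so `s₁ → −∞` gives the INTERIOR TAMENESS BOUND
`(1+|x|²/R²)⁻¹ ⟪∇u(s,x)e,e⟫ ≤ (U/R + 6ν/R²)/(1 − c)` for all `s < 0`: wherever the strain maximisers seen at
resolution `R` are sub-parity throughout the past, the stretching rate is at most the TURNOVER RATE at scale `R`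
(content exactly where `R ≫ ν/U`, below the free bound `‖∇u‖ ≲ U²/ν` of bounded mild ancient solutions). This is
the Navier–Stokes transplant of Chen's LOCAL curvature pinching `R ≥ −C/r²` for ancient / complete Ricci flows
(B.-L. Chen 2009; Cho–Li, arXiv:2005.11866, Prop. 2.1), with the penalisation weight in place of Chen's cutoff and
the drift + diffusion allowance `U/R + 6ν/R²` in place of `C/r²`. The EXACT-maximiser threshold device p655218
(`ArgmaxDoors.rayleigh_le_supersolution_of_argmax_growth`, decay supplied by the weight) is the engine — plate
E2_S^w «StrainThresholdWeightedOn», NEW, keyed to ns-sfl-p1 g5. Corollaries: the pointwise bound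
`⟪∇u(s,x)e,e⟫ ≤ (1+ε|x|²)·η(ε)/κ`, and (C2) «PenalisedClockLiouville»: sub-parity at the exact penalised maximisers
for EVERY `0 < ε ≤ 1` forces `S ≤ 0`, hence (trace step + «RigidMotion») `u(s,·)` constant — a conditional Liouville
theorem whose hypothesis is charged on the ONE-PARAMETER FAMILY of exact penalised maximisers (a curve of points per
time), logically independent of S38-A1 (almost-maximisers, an open set of points). (C3) «ForwardStrainSmoothing»: the
forward twin on `[t₀,T)` — `w_ε q(t) ≤ η(ε)/κ + 1/(κ(t − t₀))` for `t₀ < t < T`, NO initial datum in the conclusion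
(the strain forgets its size within one turnover inside sub-parity pockets).

(C4) «IntegratedClockNoStretching» / «IntegratedClockLiouville» — MEMORY. Replace S38-A1's constant ratio `c` by a
time-dependent envelope `θ(s) ≤ 1` of the feed ratio `H/q²` at the charged almost-maximisers: the clock reads
`d(1/Λ)/ds ≥ 1 − θ(s)`, the barrier is `B = (L'⁻¹ + ∫_{s₁}^{s}(1−θ))⁻¹` (`B' = −(1−θ)B² = φB` exactly), and
`∫_{−∞}(1 − θ) = +∞` forces `Λ ≤ 0`, hence Liouville. Contrapositive: along a NON-TRIVIAL bounded ancient solution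
FEEDING PARITY HOLDS UP TO AN INTEGRABLE DEFICIT over the whole past — for every continuous envelope `θ ≤ 1` of the
feed ratio, `sup_{s₁<s₂} ∫_{s₁}^{s₂}(1−θ) < ∞` (S38-A1 = the case `θ ≡ c < 1`).

* §0 (v2): the S38 support (`strainRateOn`, `strainQuad_le_opNorm`, `tendsto_allowance`, F_S∘ «StrainFrameOn», E2_S∘
  «StrainThresholdOn», «RigidMotion», the trace step and their closers) is IMPORTED from the landed P0-38 files
  (p664543 / p665030 / p665638); nothing is re-declared.
* §1 `IsStrainPenalisedArgmax`; doors C1 «LocalStrainTameness», C2 «PenalisedClockLiouville», C3 «ForwardStrainSmoothing».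
* §2 doors C4♮ «IntegratedClockNoStretching», C4 «IntegratedClockLiouville».
* §3 plate E2_S^w «StrainThresholdWeightedOn» (S; LANDED p664793 `ArgmaxDoors.strainThresholdWeighted`, ns-sfl-p1 g5; closed BY NAME).
* §4 compositions; §5 closers (`strainThresholdWeightedOn_holds := strainThresholdWeighted` + the five doors).

HONEST LABEL: conditional, QUANTITATIVE interior bounds and conditional Liouville theorems for bounded ancient
solutions (hard core H2 10661 `TypeIliouvilleL` FACED as the conclusion of C2/C4, NOT proved), one forward a-priori
interior bound in a bounded-velocity frame (C3; a bound, NOT a continuation criterion). WHAT THIS IS NOT: item 0056 `NoTypeII`, item 10661 and NS regularity are NOT proved; no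
Literature fact is a hypothesis; nothing here is a route or a summit statement (`--supports
stmt-NavierStokesRegularity-0056 --as helper`, Theorems-only landings by the S-lane).
-/

noncomputable section

open MeasureTheory Set Function Filter Metric Real InnerProductSpace
open _root_.Topology
open scoped ENNReal NNReal RealInnerProductSpace ContDiff Laplacian Interval
open Literature.Analysis Literature.Analysis.FluidPDE
open Literature.Analysis.FluidPDE.VorticityDirectionDynamics

set_option linter.dupNamespace false

namespace Summit.NavierStokesRegularity.NavierStokesRegularity.Theorems.StrainDoors

open Summit.NavierStokesRegularity.NavierStokesRegularity.Theorems.ArgmaxDoors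

-- nested operator types (second derivatives)
set_option maxSynthPendingDepth 3
/-! ## §0 (v2) The S38 support items `strainRateOn`, `strainQuad_le_opNorm`, `tendsto_allowance`, `StrainFrameOn`,
`StrainThresholdOn`, `RigidMotion`, the trace step and the closers `strainFrameOn_holds`, `strainThresholdOn_holds`,
`rigidMotion_holds` are now TREE DECLARATIONS (P0-38: p664543 `StrainClockDoorsDefs`, p665030 `StrainClockDoorsCompositions`,
p665638 `StrainClockDoorsClosers`, same namespace) and are used BY NAME; the plate E2_S^w is closed BY NAME over
p664793 `ArgmaxDoors.strainThresholdWeighted` (ns-sfl-p1 g5). Texts §1–§3 byte-identical to v1 (02597aec9189dd4e). -/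

/-! ## §1 Resolution: doors C1 «LocalStrainTameness», C2 «PenalisedClockLiouville», C3 «ForwardStrainSmoothing» -/

/-- support (definition): `(x,e)` is an EXACT maximiser of the `ε`-PENALISED strain form at time `t` (resolution
`R = ε^{-1/2}` about the origin): `|e| = 1` and `(1+ε|y|²)⁻¹⟪∇u(t,y)e',e'⟫ ≤ (1+ε|x|²)⁻¹⟪∇u(t,x)e,e⟫` for every `y`
and every unit `e'` (the penalised maximisers of the devices p657155 / p655218; they exist by compactness whenever the
penalised form is positive somewhere — not used). -/
def IsStrainPenalisedArgmax (ε : ℝ) (u : ℝ → (EuclideanSpace ℝ (Fin 3)) → (EuclideanSpace ℝ (Fin 3))) (t : ℝ)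
    (x e : EuclideanSpace ℝ (Fin 3)) : Prop :=
  ‖e‖ = 1 ∧ ∀ (y e' : EuclideanSpace ℝ (Fin 3)), ‖e'‖ = 1 →
    (1 + ε * ‖y‖ ^ 2)⁻¹ * strainQuad u t y e' ≤ (1 + ε * ‖x‖ ^ 2)⁻¹ * strainQuad u t x e

/-- door S39-C1 «LocalStrainTameness» (conditional INTERIOR bound at fixed resolution; the NS transplant of Chen's local
pinching). THE ANCIENT FRAME of S38-A1: `ν > 0`; `(u,p)` classical on every backward slab `[s₁,s₂] ⊂ (−∞,0)`;
`|u| ≤ U`, `‖∇u‖ ≤ L` on `(−∞,0) × ℝ³`. RESOLUTION `ε > 0` FIXED; ratio `c < 1`. HYPOTHESIS, charged at every EXACT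
maximiser `(x,e)` of the `ε`-penalised strain form at times `s < 0` with `⟪∇u(s,x)e,e⟫ > 0`: feed sub-parity
`¼(|ω|² − ⟪ω,e⟫²) − ∇²p(e,e) ≤ c·⟪∇u e,e⟫²`. CONCLUSION: for ALL `s < 0`, `x`, unit `e`:
`(1+ε|x|²)⁻¹⟪∇u(s,x)e,e⟫ ≤ (6νε + √ε·U)/(1 − c)` — with `ε = R⁻²`, the stretching rate inside the resolved ball is
at most the turnover rate `(U/R + 6ν/R²)/(1−c)`. -/
def LocalStrainTameness : Prop :=
  ∀ (ν U L ε c : ℝ), 0 < ν → 0 < ε → c < 1 →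
    ∀ (u : ℝ → (EuclideanSpace ℝ (Fin 3)) → (EuclideanSpace ℝ (Fin 3)))
      (p : ℝ → (EuclideanSpace ℝ (Fin 3)) → ℝ),
      (∀ s₁ s₂ : ℝ, s₁ < s₂ → s₂ < 0 → IsClassicalNSSolutionOn (Icc s₁ s₂) ν 0 u p) →
      (∀ s : ℝ, s < 0 → ∀ x : EuclideanSpace ℝ (Fin 3), ‖u s x‖ ≤ U) →
      (∀ s : ℝ, s < 0 → ∀ x : EuclideanSpace ℝ (Fin 3), ‖fderiv ℝ (u s) x‖ ≤ L) →
      (∀ s : ℝ, s < 0 → ∀ (x e : EuclideanSpace ℝ (Fin 3)), IsStrainPenalisedArgmax ε u s x e →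
        0 < strainQuad u s x e → strainFeed u p s x e ≤ c * strainQuad u s x e ^ 2) →
      ∀ s : ℝ, s < 0 → ∀ (x e : EuclideanSpace ℝ (Fin 3)), ‖e‖ = 1 →
        (1 + ε * ‖x‖ ^ 2)⁻¹ * strainQuad u s x e ≤ (6 * ν * ε + Real.sqrt ε * U) / (1 - c)

/-- door S39-C2 «PenalisedClockLiouville» (conditional Liouville theorem; C1 at every resolution). Same ancient frame;
`c < 1`. HYPOTHESIS: for EVERY `0 < ε ≤ 1`, feed sub-parity `H ≤ c·⟪∇u e,e⟫²` at every exact maximiser of the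
`ε`-penalised strain form with `⟪∇u e,e⟫ > 0` (a one-parameter family of points per time). CONCLUSION: `u(s,·)` is
constant for every `s < 0` (C1 gives `⟪∇u(s,x)e,e⟫ ≤ (1+ε|x|²)(6νε + √εU)/(1−c) → 0`; trace step; «RigidMotion»). -/
def PenalisedClockLiouville : Prop :=
  ∀ (ν U L c : ℝ), 0 < ν → c < 1 →
    ∀ (u : ℝ → (EuclideanSpace ℝ (Fin 3)) → (EuclideanSpace ℝ (Fin 3)))
      (p : ℝ → (EuclideanSpace ℝ (Fin 3)) → ℝ),
      (∀ s₁ s₂ : ℝ, s₁ < s₂ → s₂ < 0 → IsClassicalNSSolutionOn (Icc s₁ s₂) ν 0 u p) →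
      (∀ s : ℝ, s < 0 → ∀ x : EuclideanSpace ℝ (Fin 3), ‖u s x‖ ≤ U) →
      (∀ s : ℝ, s < 0 → ∀ x : EuclideanSpace ℝ (Fin 3), ‖fderiv ℝ (u s) x‖ ≤ L) →
      (∀ ε : ℝ, 0 < ε → ε ≤ 1 → ∀ s : ℝ, s < 0 → ∀ (x e : EuclideanSpace ℝ (Fin 3)),
        IsStrainPenalisedArgmax ε u s x e → 0 < strainQuad u s x e →
        strainFeed u p s x e ≤ c * strainQuad u s x e ^ 2) →
      ∀ s : ℝ, s < 0 → ∀ x y : EuclideanSpace ℝ (Fin 3), u s x = u s y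

/-- door S39-C3 «ForwardStrainSmoothing» (a-priori interior smoothing estimate, forward). THE FORWARD FRAME: `ν > 0`,
`0 ≤ t₀ < T`; `(u,p)` classical on `[0,T)`; `|u| ≤ U` on `[t₀,T) × ℝ³`; `∇u` bounded on every closed sub-slab
`[t₀,T'] ⊂ [t₀,T)` (no decay, no blow-up assumed or excluded). RESOLUTION `ε > 0`, ratio `c < 1`. HYPOTHESIS: feed
sub-parity `H ≤ c·⟪∇u e,e⟫²` at every exact maximiser of the `ε`-penalised strain form at times `t ∈ [t₀,T)` with
`⟪∇u e,e⟫ > 0`. CONCLUSION: for `t₀ < t < T`, all `x`, unit `e`: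
`(1+ε|x|²)⁻¹⟪∇u(t,x)e,e⟫ ≤ (6νε + √εU)/(1−c) + 1/((1−c)(t − t₀))` — NO initial datum on the right (barrier
`η/κ + (L'⁻¹ + κ(t−t₀))⁻¹ ≤ η/κ + 1/(κ(t−t₀))`). -/
def ForwardStrainSmoothing : Prop :=
  ∀ (ν T t₀ U ε c : ℝ), 0 < ν → 0 ≤ t₀ → t₀ < T → 0 < ε → c < 1 →
    ∀ (u : ℝ → (EuclideanSpace ℝ (Fin 3)) → (EuclideanSpace ℝ (Fin 3)))
      (p : ℝ → (EuclideanSpace ℝ (Fin 3)) → ℝ),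
      IsClassicalNSSolutionOn (Ico 0 T) ν 0 u p →
      (∀ t ∈ Ico t₀ T, ∀ x : EuclideanSpace ℝ (Fin 3), ‖u t x‖ ≤ U) →
      (∀ T' : ℝ, T' < T → ∃ K : ℝ, ∀ t ∈ Icc t₀ T', ∀ x : EuclideanSpace ℝ (Fin 3), ‖fderiv ℝ (u t) x‖ ≤ K) →
      (∀ t ∈ Ico t₀ T, ∀ (x e : EuclideanSpace ℝ (Fin 3)), IsStrainPenalisedArgmax ε u t x e →
        0 < strainQuad u t x e → strainFeed u p t x e ≤ c * strainQuad u t x e ^ 2) →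
      ∀ t ∈ Ioo t₀ T, ∀ (x e : EuclideanSpace ℝ (Fin 3)), ‖e‖ = 1 →
        (1 + ε * ‖x‖ ^ 2)⁻¹ * strainQuad u t x e ≤
          (6 * ν * ε + Real.sqrt ε * U) / (1 - c) + 1 / ((1 - c) * (t - t₀))

/-! ## §2 Memory: doors C4♮ «IntegratedClockNoStretching», C4 «IntegratedClockLiouville» -/

/-- door S39-C4♮ «IntegratedClockNoStretching» (conditional Liouville, first half; S38-A1♮ with a time-dependent
ratio). The ancient frame of S38-A1; `0 < δ < 1`; a continuous RATIO ENVELOPE `θ : ℝ → ℝ` with `θ ≤ 1` and DIVERGENT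
DEFICIT `∫_{−∞}^{s₂}(1 − θ) = +∞` (for every `s₂ < 0` and `M` some `s₁ < s₂` has `∫_{s₁}^{s₂}(1 − θ) ≥ M`).
HYPOTHESIS, charged at every `(1−δ)`-almost strain maximiser `(x,e)` at times `s < 0` with `⟪∇u e,e⟫ > 0`:
`¼(|ω|² − ⟪ω,e⟫²) − ∇²p(e,e) ≤ θ(s)·⟪∇u e,e⟫²`. CONCLUSION: `⟪∇u(s,x)e,e⟫ ≤ 0` for all `s < 0`, `x`, unit `e`
(barrier `B = (L'⁻¹ + ∫_{s₁}^{s}(1−θ))⁻¹`, `B' = −(1−θ)B²`). S38-A1♮ is the case `θ ≡ c < 1`. -/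
def IntegratedClockNoStretching : Prop :=
  ∀ (ν U L δ : ℝ) (θ : ℝ → ℝ), 0 < ν → 0 < δ → δ < 1 → Continuous θ → (∀ s : ℝ, θ s ≤ 1) →
    (∀ s₂ : ℝ, s₂ < 0 → ∀ M : ℝ, ∃ s₁ : ℝ, s₁ < s₂ ∧ M ≤ ∫ r in s₁..s₂, (1 - θ r)) →
    ∀ (u : ℝ → (EuclideanSpace ℝ (Fin 3)) → (EuclideanSpace ℝ (Fin 3)))
      (p : ℝ → (EuclideanSpace ℝ (Fin 3)) → ℝ),
      (∀ s₁ s₂ : ℝ, s₁ < s₂ → s₂ < 0 → IsClassicalNSSolutionOn (Icc s₁ s₂) ν 0 u p) →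
      (∀ s : ℝ, s < 0 → ∀ x : EuclideanSpace ℝ (Fin 3), ‖u s x‖ ≤ U) →
      (∀ s : ℝ, s < 0 → ∀ x : EuclideanSpace ℝ (Fin 3), ‖fderiv ℝ (u s) x‖ ≤ L) →
      (∀ s : ℝ, s < 0 → ∀ (x e : EuclideanSpace ℝ (Fin 3)), IsStrainAlmostArgmax δ u s x e →
        0 < strainQuad u s x e → strainFeed u p s x e ≤ θ s * strainQuad u s x e ^ 2) →
      ∀ s : ℝ, s < 0 → ∀ (x e : EuclideanSpace ℝ (Fin 3)), ‖e‖ = 1 → strainQuad u s x e ≤ 0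

/-- door S39-C4 «IntegratedClockLiouville» (conditional Liouville theorem: FEEDING PARITY UP TO AN INTEGRABLE DEFICIT).
Same frame and hypothesis as C4♮. CONCLUSION: `u(s,·)` is constant for every `s < 0`. Contrapositive: along a
non-trivial bounded ancient solution, every continuous envelope `θ ≤ 1` of the feed ratio at the charged almost
strain maximisers has `sup_{s₁ < s₂} ∫_{s₁}^{s₂}(1 − θ) < ∞`. -/
def IntegratedClockLiouville : Prop :=
  ∀ (ν U L δ : ℝ) (θ : ℝ → ℝ), 0 < ν → 0 < δ → δ < 1 → Continuous θ → (∀ s : ℝ, θ s ≤ 1) →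
    (∀ s₂ : ℝ, s₂ < 0 → ∀ M : ℝ, ∃ s₁ : ℝ, s₁ < s₂ ∧ M ≤ ∫ r in s₁..s₂, (1 - θ r)) →
    ∀ (u : ℝ → (EuclideanSpace ℝ (Fin 3)) → (EuclideanSpace ℝ (Fin 3)))
      (p : ℝ → (EuclideanSpace ℝ (Fin 3)) → ℝ),
      (∀ s₁ s₂ : ℝ, s₁ < s₂ → s₂ < 0 → IsClassicalNSSolutionOn (Icc s₁ s₂) ν 0 u p) →
      (∀ s : ℝ, s < 0 → ∀ x : EuclideanSpace ℝ (Fin 3), ‖u s x‖ ≤ U) →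
      (∀ s : ℝ, s < 0 → ∀ x : EuclideanSpace ℝ (Fin 3), ‖fderiv ℝ (u s) x‖ ≤ L) →
      (∀ s : ℝ, s < 0 → ∀ (x e : EuclideanSpace ℝ (Fin 3)), IsStrainAlmostArgmax δ u s x e →
        0 < strainQuad u s x e → strainFeed u p s x e ≤ θ s * strainQuad u s x e ^ 2) →
      ∀ s : ℝ, s < 0 → ∀ x y : EuclideanSpace ℝ (Fin 3), u s x = u s y

/-! ## §3 Plate E2_S^w «StrainThresholdWeightedOn» (NEW; S-lane, keyed to ns-sfl-p1 g5) -/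

/-- plate E2_S^w «StrainThresholdWeightedOn» (S; the EXACT-maximiser threshold device p655218
`ArgmaxDoors.rayleigh_le_supersolution_of_argmax_growth` on a closed slab with the FIXED penalisation weight —
`W(r,y) := (1+ε|y|²)⁻¹ • ∇u(s₁ + r, y)` is jointly smooth and decays uniformly since `‖∇u‖ ≤ K`; time shift as in
p661976). `(u,p)` classical on `[s₁,s₂]` (`ν > 0`) with `‖∇u‖ ≤ K`; `ε > 0`; `B > 0` continuous with `φB ≤ B'` within
`[s₁,s₂]`. IF at every `s ∈ (s₁,s₂]` and every exact maximiser `(x,e)`, `|e| = 1`, of the penalised form with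
`(1+ε|x|²)⁻¹⟪∇u e,e⟫ > B(s)`: `(1+ε|x|²)⁻¹⟪∂ₛ(∇u e),e⟫ ≤ φ(s)·(1+ε|x|²)⁻¹⟪∇u e,e⟫ — THEN the weighted bound
`(1+ε|y|²)⁻¹⟪∇u(s₁,y)e,e⟫ ≤ B(s₁)` propagates along the slab. No almost-maximisers, no `η`, no `δ`. -/
def StrainThresholdWeightedOn : Prop :=
  ∀ (ν s₁ s₂ ε : ℝ), 0 < ν → s₁ < s₂ → 0 < ε →
    ∀ (u : ℝ → (EuclideanSpace ℝ (Fin 3)) → (EuclideanSpace ℝ (Fin 3)))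
      (p : ℝ → (EuclideanSpace ℝ (Fin 3)) → ℝ),
      IsClassicalNSSolutionOn (Icc s₁ s₂) ν 0 u p →
      (∃ K : ℝ, ∀ s ∈ Icc s₁ s₂, ∀ x : EuclideanSpace ℝ (Fin 3), ‖fderiv ℝ (u s) x‖ ≤ K) →
      ∀ (B B' φ : ℝ → ℝ), ContinuousOn B (Icc s₁ s₂) → (∀ s ∈ Icc s₁ s₂, 0 < B s) →
        (∀ s ∈ Icc s₁ s₂, HasDerivWithinAt B (B' s) (Icc s₁ s₂) s) →
        (∀ s ∈ Icc s₁ s₂, φ s * B s ≤ B' s) →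
        (∀ s ∈ Ioc s₁ s₂, ∀ (x e : EuclideanSpace ℝ (Fin 3)), ‖e‖ = 1 →
          (∀ (y e' : EuclideanSpace ℝ (Fin 3)), ‖e'‖ = 1 →
            (1 + ε * ‖y‖ ^ 2)⁻¹ * strainQuad u s y e' ≤ (1 + ε * ‖x‖ ^ 2)⁻¹ * strainQuad u s x e) →
          B s < (1 + ε * ‖x‖ ^ 2)⁻¹ * strainQuad u s x e →
          (1 + ε * ‖x‖ ^ 2)⁻¹ * strainRateOn (Icc s₁ s₂) u s x e ≤
            φ s * ((1 + ε * ‖x‖ ^ 2)⁻¹ * strainQuad u s x e)) →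
        (∀ (x e : EuclideanSpace ℝ (Fin 3)), ‖e‖ = 1 → (1 + ε * ‖x‖ ^ 2)⁻¹ * strainQuad u s₁ x e ≤ B s₁) →
        ∀ s ∈ Icc s₁ s₂, ∀ (x e : EuclideanSpace ℝ (Fin 3)), ‖e‖ = 1 →
          (1 + ε * ‖x‖ ^ 2)⁻¹ * strainQuad u s x e ≤ B s

end Summit.NavierStokesRegularity.NavierStokesRegularity.Theorems.StrainDoors

end
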